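import Literature.MathematicalPhysics.QuantumFieldTheory.Balaban1983to89.T4TaggedShapeBanking

/-!
# `Balaban1983to89.T4CanonicalMenus` — the count's MENUS INSTANTIATED from the dictionary (one renewal shape and one
merger shape per step, the birth kinds `dictB` as root and partner menus), its four BUDGETS COMPUTED in the constants
(`a = μ = e^{−E₀}`, `ν = ρ̄ =` the geometric birth mass), and the MEMBERSHIP HALF of the labelling binder made kernel:
the shape of a consistent tagged genealogy within the caps IS a record of the canonical run IFF the genealogy is
CHRONOLOGICAL (cell `pub-balaban`, T4-DAG §5 self-row T4-U5c.E-NE7b-MENUS-K* (§8 Q24(a)), node U5c / U5.E, spine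
estimate NE7b, COUNT member P1 "Peierls / entropy–energy counting of persistent large-field histories", gen 15; record
`t4/T4-EST-NE7b-P1.md` v1.15; GAPS: the "∈ runFam" / "∃ old slot" residue of `hlabT` / `hstr` located by the XREAD
supplement C-ne7bp2g15-1 (INFO I-4) and census item (y)(iv) of the record (menus / budgets left symbolic); kernel
bookkeeping — finite combinatorics + real arithmetic; imports `T4TaggedShapeBanking` (this lineage, v1 p193152) BY NAME
and modifies nothing.  VERSION v1 = this file.)

HONEST FRAMING (T4-DAG PAGE 1).  The cell's T4 target is the existence and uniqueness of the `ε → 0` limit of unit-scale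
block-averaged expectations on a FIXED finite torus, at rung (B)+1, CONDITIONAL on Bałaban's ultraviolet stability (B)
and on BetaPertH; it is NOT infinite volume, NOT the mass gap, NOT the Clay problem.  This module is [folklore] finite
combinatorics and real analysis and READS NOTHING NEW from print: no sentence of [Balaban1989LargeFieldII] (cell paper
B16, CMP 122 (1989) 355–392) or of [Balaban1988Convergent] (B14, CMP 119 (1988) 243–285) is a hypothesis of anything
here, and nothing is quoted.  (B), BetaPertH, (B^μ), the reading (ID), the geometric multiplicity (GM), the caps and the
flow are DISPLAYED BINDERS of the theorems below, exactly as in `T4TaggedShapeBanking` — none is hidden in a definition.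
Value = a kernel certificate about OUR OWN counting chain; NOT an estimate of Bałaban's expansion; NOT summit progress;
NOT a proof of NE7b.

THE LOCATED POINT (XREAD supplement C-ne7bp2g15-1, INFO I-4; record census (y)(iv)).  The lineage's end-to-end theorem
`T4TaggedShapeBanking.exists_irThreshold_relWeightBoundT` counts over `runFam Lren Lmer Lpart Lroot Ncap K j` for
ARBITRARY menus, with a step-faithfulness binder `hst` and four displayed budgets `ρ̄, a, μ, ν`; its labelling binder
`hlabT` asks, per counted shape `G`, for a consistent well-formed pending TAGGED genealogy `G̃` with
`relabel (shape ∘ sh) G̃ = G`, and its structure binder `hstr` asks the injected slot families to lie in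
`bliveSlots Cell (runFam …) K` and to contain an old slot.  Two things there are OURS, not print's: (a) WHICH menus — the
dictionary `T4PersistenceDictionary` already fixes the event kinds: a renewal recorded at step `t` has shape `(t, 1, 0)`, a
merger `(t, 2, 0)`, a birth of class `d′ < Dcap K` at step `s` is the birth kind `(s, 0, d′) ∈ dictB Dcap K s`; (b) given a
consistent tagged genealogy `G̃` — what (ID) is to deliver per pending structure — IS its shape a member of the run
family at all, and is its branching slot live / old?  THIS MODULE settles both on the kernel side.  (a) It plugs the
CANONICAL MENUS (§1) and COMPUTES the budgets (§5): `Σ_{menuRen t} η = Σ_{menuMer t} η = e^{−E₀}` exactly, and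
`Σ_{dictB Dcap K s} η ≤ birthMass C`, `Σ_{dictB Dcap K j} ρ ≤ birthMass C := e^{−Eb}·e^{−μ}/(1 − e^{−μ})` (the geometric
series over classes, UNIFORM in the cap), so `hst` and the four budget binders disappear from the end-to-end statement
(§6) at the cost of two displayed binders in the constants / the run: `0 < μ` (`Consts.Valid` only has `μ ≥ 0`) and
`0 ≤ p₀(g_{K,s})` (met by `0 < g ≤ 1`).  (b) It proves (§3, §4) that for a consistent tagged genealogy within the caps
(birth classes `< Dcap K`, fuel `≤ Ncap K`) membership of its shape in the canonical run family is EQUIVALENT to a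
DECIDABLE structural predicate `Chrono` on the term — a renewal is recorded after every event already on its line
(automatic under consistency: it is recorded AT the line's reach, `consistentT_chrono_renew`), a merger lists the
OLDER line first and is recorded no earlier than any event of either partner — (`mem_canonFam_iff_chrono`), and that
its branching slot is then live, and old when born before the cut (`mem_bliveSlots_of_chrono`, `mem_boldSlots_of_chrono`).
A consistent, well-formed, pending but NON-chronological term exists (§7 `Nc`: a merger recorded at step `3` absorbing a
line renewed at step `4`) and its shape is in NO canonical family — so the chronology clause is load-bearing, and what
(ID) + (GM) must deliver is thereby SHARPENED, not enlarged: per pending structure of cutoff `K`, a consistent,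
well-formed, CHRONOLOGICAL tagged genealogy within the caps, priced with multiplicity `Λ′^{partnerAges}`.
  §1 THE CANONICAL MENUS `menuRen t = {(t,1,0)}`, `menuMer t = {(t,2,0)}`, root / partner menus `dictB Dcap K ·`;
     `canonFam Dcap Ncap := runFam menuRen menuMer (dictB Dcap) (dictB Dcap) Ncap`; step-faithfulness (`menuMer_step` is
     the binder `hst`).
  §2 FUEL, LATEST STEP, CHRONOLOGY of a genealogy term over ANY label type, read through a step map `st : ε → ℕ`
     (`fuel`, `maxStep`, `Chrono` — decidable), invariant under step-preserving relabelling (`fuel_relabel`,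
     `maxStep_relabel`, `chrono_relabel_iff`; in particular under `shape ∘ sh`).
  §3 COUNTED ⇒ CHRONOLOGICAL: every record of `fam Lren Lmer Lpart n Lb s T` over step-faithful menus is chronological
     with events `≤ T` (`chrono_of_mem_fam`) and fuel `≤ n` (`fuel_le_of_mem_fam`).
  §4 CHRONOLOGICAL ⇒ COUNTED: the invariants of consistent tagged genealogies `maxStep < reach`, `rootStep < reach`,
     `maxStep ≤ K`, `rootStep ≤ K`; `mem_fam_of_chrono` (structural induction: `born_mem_fam` / `renew_mem_fam` at
     `t = h + 1 = reach` / `merge_mem_fam` with the partner born at `s′ ∈ [rootStep, t]`), `mem_canonFam_of_chrono`,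
     `mem_canonFam_iff_chrono`, `mem_bliveSlots_of_chrono`, `mem_boldSlots_of_chrono`.
  §5 THE BUDGETS in the constants (`sum_menuRen_eta`, `sum_menuMer_eta`, `birthMass`, `sum_dictB_eta_le`,
     `sum_dictB_rho_le`, `p0Profile_nonneg_of_le_one`).
  §6 END TO END `exists_irThreshold_relWeightBound_canon` = `exists_irThreshold_relWeightBoundT` over `canonFam Dcap Ncap`
     with `hst` and the four budgets DISCHARGED: binders `0 < μ`, `∀ K s, 0 ≤ p₀(g_{K,s})`; the fixed-point side condition
     is now the explicit inequality `(e^{−E₀} + e^{−E₀}·birthMass C·(Λ′e^{−κ₁}/(1 − Λ′e^{−κ₁}e^{η̄₊})))·e^{η̄₊} ≤ e^{η̄₊} − 1`;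
     conclusion `∃ K₁ ≥ K₀, RelWeightBound …` with budget `𝟙_{K ≥ K₁}·C·recordsBudget (birthMass C) κ₁ V Λ η̄₊ j⋆ K`.
  §7 SANITY (decided / by `simp`): the tagged two-branch history `Zt` of `T4TaggedShapeBanking` §8 is chronological, and
     its count membership — assembled by hand in gen 14 (`Zflat_mem`) — is now the COROLLARY `Zt_mem_canonFam` of §4
     (for every pair of caps allowing thin classes and fuel `3`; caps symbolic, so that nothing enumerates the family);
     the term `Nc` is consistent, well formed and pending at cutoff `8` but not chronological, and its shape lies in no
     canonical family (`Nc_not_mem`).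
WHAT THIS DOES NOT DO.  (i) It does not discharge `hlabT`: that every pending structure of cutoff `K` is priced by SOME
consistent, well-formed, chronological tagged genealogy within the caps, with multiplicity `Λ′^{partnerAges}`, is the
READING (ID) of print's inductive definition of the persistent regions plus the geometric multiplicity statement (GM) —
GAPS G-ne7bp1g9-1 / G-ne7bp1g12-1, owner O-R10 — displayed (over `canonFam Dcap Ncap` now).  (ii) The caps `Dcap`
(classes per cutoff) and `Ncap` (fuel per cutoff), the cells, `η̄₊`, the age datum `Λ′` with its rate and the fixed-point
inequality, the root rate, the cut `j⋆`, the two `Regeneration` runs and the domination `hF` stay displayed; `0 < μ` and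
`0 ≤ p₀` are displayed.  (iii) It does not touch the typed flow, the infrared smallness, (G2)/(G5), or any module of
another seat; it is additive: new names next to the objects of `T4BranchingRecordsGas` / `T4TaggedShapeBanking`, none
of which changes.

References (locators only, nothing quoted): [Balaban1989LargeFieldII] (1.79) p. 383, (1.82) p. 385, (1.84)–(1.89)
pp. 385–388; [Balaban1988Convergent] (2.5), (2.7) p. 255, (2.9) p. 256 — as typed in `B14` / `B14FlowStep` and read in
`T4PrintedShapeBanking` / `T4PersistenceDictionary` / `T4RecordPriceSeam` / `T4BranchingRecordsGas` / `T4TaggedShapeBanking`.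
-/

open Finset

namespace Literature.MathematicalPhysics.QuantumFieldTheory.Balaban1983to89

namespace T4CanonicalMenus

open T4PersistenceDictionary T4PersistentHistoryCount T4BankedInduction T4PrintedShapeBanking
open T4WeightBudget T4GlobalDenominator T4LiveClassFibration T4LiveStructureGas T4LiveGasToTerms T4RecordPriceSeam
open T4PartnerMultiplicity T4BranchingRecordsGas T4TaggedShapeBanking

noncomputable section

/-! ## §1 The canonical menus -/

section Menus

/-- **THE RENEWAL MENU**: ONE label `(t, 1, 0)` per step — the shape of every renewal recorded at step `t`. [folklore] -/
def menuRen (t : ℕ) : Finset PEv := {((t, 1, 0) : PEv)}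

/-- **THE MERGER MENU**: ONE label `(t, 2, 0)` per step — the shape of every binary merger recorded at step `t`. [folklore] -/
def menuMer (t : ℕ) : Finset PEv := {((t, 2, 0) : PEv)}

/-- membership in the renewal menu [folklore] -/
@[simp] theorem mem_menuRen {t : ℕ} {e : PEv} : e ∈ menuRen t ↔ e = ((t, 1, 0) : PEv) := by simp [menuRen]

/-- membership in the merger menu [folklore] -/
@[simp] theorem mem_menuMer {t : ℕ} {e : PEv} : e ∈ menuMer t ↔ e = ((t, 2, 0) : PEv) := by simp [menuMer]

/-- the renewal menu at `t` is step-faithful [folklore] -/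
theorem menuRen_step (t : ℕ) : ∀ e ∈ menuRen t, PEv.step e = t := by simp

/-- the merger menu at `t` is step-faithful (the binder `hst` of the count, discharged) [folklore] -/
theorem menuMer_step (t : ℕ) : ∀ e ∈ menuMer t, PEv.step e = t := by simp

/-- the birth kinds at `s` are step-faithful [folklore] -/
theorem dictB_step (Dcap : ℕ → ℕ) (K s : ℕ) : ∀ b ∈ dictB Dcap K s, PEv.step b = s :=
  fun _ hb => (mem_dictB.1 hb).1

/-- **THE CANONICAL BRANCHING RECORDS OF THE RUN** at cutoff `K`, birth step `j`: fuel `Ncap K`, root menu and partner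
menus = the dictionary's birth kinds `dictB Dcap K ·` (classes `< Dcap K`), renewal / merger menus `menuRen` / `menuMer`
— `T4BranchingRecordsGas.runFam` with these menus plugged. [folklore] -/
abbrev canonFam (Dcap Ncap : ℕ → ℕ) : ℕ → ℕ → Finset (Gen PEv) :=
  runFam (fun _ => menuRen) (fun _ => menuMer) (dictB Dcap) (dictB Dcap) Ncap

/-- the canonical run family unfolded [folklore] -/
theorem canonFam_eq (Dcap Ncap : ℕ → ℕ) (K j : ℕ) :
    canonFam Dcap Ncap K j = fam menuRen menuMer (dictB Dcap K) (Ncap K) (dictB Dcap K j) j K := rfl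

end Menus

/-! ## §2 Fuel, latest step, and the chronology predicate of a genealogy term -/

section Chrono

variable {ε δ : Type*}

/-- **THE FUEL** a genealogy term consumes in `T4BranchingRecordsGas.fam`: a bare birth `1`, a renewal one more than its
line, a merger one more than the larger of its two lines. [folklore] -/
def fuel : Gen ε → ℕ
  | Gen.born _ _ => 1
  | Gen.renew G _ _ => fuel G + 1
  | Gen.merge X Y _ => max (fuel X) (fuel Y) + 1

/-- **THE LATEST EVENT STEP** of a genealogy term, read through a step map `st`. [folklore] -/
def maxStep (st : ε → ℕ) : Gen ε → ℕ
  | Gen.born b _ => st b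
  | Gen.renew G e _ => max (maxStep st G) (st e)
  | Gen.merge X Y e => max (max (maxStep st X) (maxStep st Y)) (st e)

/-- **CHRONOLOGY** = the time order in which `T4BranchingRecordsGas.fam` builds its terms: a renewal is recorded strictly
after its line's root birth and no earlier than any event already on the line; a merger lists the OLDER line first, is
recorded strictly after that line's root birth, and no earlier than any event of either partner. [folklore] -/
def Chrono (st : ε → ℕ) : Gen ε → Prop
  | Gen.born _ _ => True
  | Gen.renew G e _ => Chrono st G ∧ G.rootStep < st e ∧ maxStep st G ≤ st e
  | Gen.merge X Y e => Chrono st X ∧ Chrono st Y ∧ X.rootStep ≤ Y.rootStep ∧ X.rootStep < st e ∧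
      maxStep st X ≤ st e ∧ maxStep st Y ≤ st e

/-- fuel of a bare birth [folklore] -/
@[simp] theorem fuel_born (b : ε) (j : ℕ) : fuel (Gen.born b j) = 1 := rfl
/-- fuel of a renewal [folklore] -/
@[simp] theorem fuel_renew (G : Gen ε) (e : ε) (h : ℕ) : fuel (Gen.renew G e h) = fuel G + 1 := rfl
/-- fuel of a merger [folklore] -/
@[simp] theorem fuel_merge (X Y : Gen ε) (e : ε) : fuel (Gen.merge X Y e) = max (fuel X) (fuel Y) + 1 := rfl
/-- latest step of a bare birth [folklore] -/
@[simp] theorem maxStep_born (st : ε → ℕ) (b : ε) (j : ℕ) : maxStep st (Gen.born b j) = st b := rfl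
/-- latest step of a renewal [folklore] -/
@[simp] theorem maxStep_renew (st : ε → ℕ) (G : Gen ε) (e : ε) (h : ℕ) :
    maxStep st (Gen.renew G e h) = max (maxStep st G) (st e) := rfl
/-- latest step of a merger [folklore] -/
@[simp] theorem maxStep_merge (st : ε → ℕ) (X Y : Gen ε) (e : ε) :
    maxStep st (Gen.merge X Y e) = max (max (maxStep st X) (maxStep st Y)) (st e) := rfl
/-- a bare birth is chronological [folklore] -/
@[simp] theorem chrono_born (st : ε → ℕ) (b : ε) (j : ℕ) : Chrono st (Gen.born b j) := trivial
/-- chronology of a renewal [folklore] -/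
theorem chrono_renew_iff (st : ε → ℕ) (G : Gen ε) (e : ε) (h : ℕ) :
    Chrono st (Gen.renew G e h) ↔ Chrono st G ∧ G.rootStep < st e ∧ maxStep st G ≤ st e := Iff.rfl
/-- chronology of a merger [folklore] -/
theorem chrono_merge_iff (st : ε → ℕ) (X Y : Gen ε) (e : ε) :
    Chrono st (Gen.merge X Y e) ↔ Chrono st X ∧ Chrono st Y ∧ X.rootStep ≤ Y.rootStep ∧ X.rootStep < st e ∧
      maxStep st X ≤ st e ∧ maxStep st Y ≤ st e := Iff.rfl

/-- chronology is decidable (for `decide` on concrete histories) [folklore] -/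
instance Chrono.instDecidable (st : ε → ℕ) : ∀ G : Gen ε, Decidable (Chrono st G)
  | Gen.born _ _ => isTrue trivial
  | Gen.renew G e _ =>
      haveI := Chrono.instDecidable st G
      inferInstanceAs (Decidable (Chrono st G ∧ G.rootStep < st e ∧ maxStep st G ≤ st e))
  | Gen.merge X Y e =>
      haveI := Chrono.instDecidable st X
      haveI := Chrono.instDecidable st Y
      inferInstanceAs (Decidable (Chrono st X ∧ Chrono st Y ∧ X.rootStep ≤ Y.rootStep ∧ X.rootStep < st e ∧
        maxStep st X ≤ st e ∧ maxStep st Y ≤ st e))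

/-- relabelling keeps the fuel [folklore] -/
@[simp] theorem fuel_relabel (f : ε → δ) : ∀ G : Gen ε, fuel (relabel f G) = fuel G
  | Gen.born b j => rfl
  | Gen.renew G e h => by simp [fuel_relabel f G]
  | Gen.merge X Y e => by simp [fuel_relabel f X, fuel_relabel f Y]

/-- relabelling along a step-preserving map keeps the latest step [folklore] -/
theorem maxStep_relabel (f : ε → δ) {st : ε → ℕ} {st' : δ → ℕ} (hst : ∀ e, st' (f e) = st e) :
    ∀ G : Gen ε, maxStep st' (relabel f G) = maxStep st G
  | Gen.born b j => by simp [hst]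
  | Gen.renew G e h => by simp [hst, maxStep_relabel f hst G]
  | Gen.merge X Y e => by simp [hst, maxStep_relabel f hst X, maxStep_relabel f hst Y]

/-- relabelling along a step-preserving map keeps chronology [folklore] -/
theorem chrono_relabel_iff (f : ε → δ) {st : ε → ℕ} {st' : δ → ℕ} (hst : ∀ e, st' (f e) = st e) :
    ∀ G : Gen ε, Chrono st' (relabel f G) ↔ Chrono st G
  | Gen.born b j => by simp
  | Gen.renew G e h => by
      simp only [relabel_renew, chrono_renew_iff, chrono_relabel_iff f hst G, rootStep_relabel, hst,
        maxStep_relabel f hst G]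
  | Gen.merge X Y e => by
      simp only [relabel_merge, chrono_merge_iff, chrono_relabel_iff f hst X, chrono_relabel_iff f hst Y,
        rootStep_relabel, hst, maxStep_relabel f hst X, maxStep_relabel f hst Y]

variable [DecidableEq ε]

/-- every event happens no later than the latest step [folklore] -/
theorem step_le_maxStep (st : ε → ℕ) : ∀ G : Gen ε, ∀ e ∈ G.events, st e ≤ maxStep st G
  | Gen.born b j, e, he => by
      simp only [Gen.events_born, Finset.mem_singleton] at he
      simp [he]
  | Gen.renew G e h, e', he' => by
      simp only [Gen.events_renew, Finset.mem_insert] at he'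
      rcases he' with rfl | he'
      · simp
      · exact (step_le_maxStep st G e' he').trans (by simp)
  | Gen.merge X Y e, e', he' => by
      simp only [Gen.events_merge, Finset.mem_insert, Finset.mem_union] at he'
      rcases he' with rfl | he' | he'
      · simp
      · exact (step_le_maxStep st X e' he').trans (by simp)
      · exact (step_le_maxStep st Y e' he').trans (by simp)

end Chrono

/-! ## §3 Every counted record is chronological, of fuel at most the family's, born at its slot -/

section CountedAreChrono

variable {δ : Type*} [DecidableEq δ] {Lren Lmer Lpart : ℕ → Finset δ} {st : δ → ℕ}

/-- **EVERY BRANCHING RECORD IS CHRONOLOGICAL** (and has its events at steps `≤` the cutoff), for step-faithful menus.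
[folklore] -/
theorem chrono_of_mem_fam (hren : ∀ t, ∀ e ∈ Lren t, st e = t) (hmer : ∀ t, ∀ e ∈ Lmer t, st e = t)
    (hpart : ∀ s, ∀ b ∈ Lpart s, st b = s) :
    ∀ (n : ℕ) (Lb : Finset δ) (s T : ℕ), (∀ b ∈ Lb, st b = s) → s ≤ T →
      ∀ G ∈ fam Lren Lmer Lpart n Lb s T, Chrono st G ∧ maxStep st G ≤ T
  | 0, Lb, s, T, _, _ => by simp
  | n + 1, Lb, s, T, hLb, hsT =>
      fam_cases (P := fun G => Chrono st G ∧ maxStep st G ≤ T)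
        (fun b hb => ⟨trivial, by rw [maxStep_born, hLb b hb]; exact hsT⟩)
        (fun t ht e he G hG => by
          obtain ⟨hst, htT⟩ := Finset.mem_Ioc.1 ht
          have ih := chrono_of_mem_fam hren hmer hpart n Lb s t hLb hst.le G hG
          have hr := rootStep_of_mem_fam n Lb s t G hG
          have he' := hren t e he
          refine ⟨⟨ih.1, ?_, ?_⟩, ?_⟩
          · rw [hr, he']; exact hst
          · rw [he']; exact ih.2
          · rw [maxStep_renew, he']; exact max_le (ih.2.trans htT) htT)
        (fun t ht e he s' hs' X hX Y hY => by
          obtain ⟨hst, htT⟩ := Finset.mem_Ioc.1 ht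
          obtain ⟨hss', hs't⟩ := Finset.mem_Icc.1 hs'
          have ihX := chrono_of_mem_fam hren hmer hpart n Lb s t hLb hst.le X hX
          have ihY := chrono_of_mem_fam hren hmer hpart n (Lpart s') s' t (hpart s') hs't Y hY
          have hrX := rootStep_of_mem_fam n Lb s t X hX
          have hrY := rootStep_of_mem_fam n (Lpart s') s' t Y hY
          have he' := hmer t e he
          refine ⟨⟨ihX.1, ihY.1, ?_, ?_, ?_, ?_⟩, ?_⟩
          · rw [hrX, hrY]; exact hss'
          · rw [hrX, he']; exact hst
          · rw [he']; exact ihX.2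
          · rw [he']; exact ihY.2
          · rw [maxStep_merge, he']; exact max_le (max_le (ihX.2.trans htT) (ihY.2.trans htT)) htT)

/-- **A RECORD OF THE FAMILY OF FUEL `n` CONSUMES AT MOST `n`**. [folklore] -/
theorem fuel_le_of_mem_fam : ∀ (n : ℕ) (Lb : Finset δ) (s T : ℕ), ∀ G ∈ fam Lren Lmer Lpart n Lb s T, fuel G ≤ n
  | 0, Lb, s, T => by simp
  | n + 1, Lb, s, T =>
      fam_cases (P := fun G => fuel G ≤ n + 1) (fun b _ => by simp)
        (fun t _ e _ G hG => by simpa using fuel_le_of_mem_fam n Lb s t G hG)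
        (fun t _ e _ s' _ X hX Y hY => by
          have hX' := fuel_le_of_mem_fam n Lb s t X hX
          have hY' := fuel_le_of_mem_fam n (Lpart s') s' t Y hY
          simpa using max_le hX' hY')

end CountedAreChrono

/-! ## §4 A consistent chronological tagged genealogy within the caps IS a canonical branching record -/

section ChronoAreCounted

variable {ε : Type*} {sh : ε → PEv} {C : T4PrintedShapeBanking.Consts} {K : ℕ} {R : ℕ → ℕ}

/-- the shape of a renewal-kind label is the renewal menu's label of its step [folklore] -/
theorem shape_of_kind1 {e : PEv} (h : e.kind = 1) : shape e = ((e.step, 1, 0) : PEv) := by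
  obtain ⟨s, k, d⟩ := e
  simp only [PEv.kind] at h
  subst h
  simp [shape, PEv.step, PEv.kind]

/-- the shape of a merger-kind label is the merger menu's label of its step [folklore] -/
theorem shape_of_kind2 {e : PEv} (h : e.kind = 2) : shape e = ((e.step, 2, 0) : PEv) := by
  obtain ⟨s, k, d⟩ := e
  simp only [PEv.kind] at h
  subst h
  simp [shape, PEv.step, PEv.kind]

/-- the shape of a birth-kind label of class `< Dcap K` is a birth kind of its step [folklore] -/
theorem shape_mem_dictB {Dcap : ℕ → ℕ} {e : PEv} (hk : e.kind = 0) (hf : e.fat < Dcap K) :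
    shape e ∈ dictB Dcap K e.step := by
  rw [mem_dictB, step_shape, kind_shape, fat_shape_of_kind0 hk]
  exact ⟨rfl, hk, hf⟩

/-- **EVERY EVENT OF A CONSISTENT TAGGED GENEALOGY HAPPENS STRICTLY BEFORE ITS REACH** (birth and renewal windows are
`≥ 1`; a merger is recorded inside both partners' pending lives). [folklore] -/
theorem consistentT_maxStep_lt_reach :
    ∀ {G : Gen ε}, ConsistentT sh C K R G → maxStep (PEv.step ∘ sh) G < G.reach (dictWT sh R C.n₁)
  | Gen.born b j, hc => by
      simp only [ConsistentT] at hc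
      obtain ⟨hk, hs, -⟩ := hc
      simp only [maxStep_born, Function.comp_apply, Gen.reach_born]
      rw [dictWT_kind0 hk]
      omega
  | Gen.renew G e h, hc => by
      simp only [ConsistentT] at hc
      obtain ⟨hG, hk, hs, hr, -⟩ := hc
      have ih := consistentT_maxStep_lt_reach hG
      simp only [maxStep_renew, Function.comp_apply, Gen.reach_renew]
      rw [dictWT_kind1 hk]
      omega
  | Gen.merge X Y e, hc => by
      simp only [ConsistentT] at hc
      obtain ⟨hX, hY, -, -, hx', -, hy', -⟩ := hc
      have ihX := consistentT_maxStep_lt_reach hX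
      have ihY := consistentT_maxStep_lt_reach hY
      simp only [maxStep_merge, Function.comp_apply, Gen.reach_merge]
      omega

/-- **… SO IT IS BORN STRICTLY BEFORE ITS REACH** [folklore] -/
theorem consistentT_rootStep_lt_reach :
    ∀ {G : Gen ε}, ConsistentT sh C K R G → G.rootStep < G.reach (dictWT sh R C.n₁)
  | Gen.born b j, hc => by
      simp only [ConsistentT] at hc
      obtain ⟨hk, -, -⟩ := hc
      simp only [Gen.rootStep_born, Gen.reach_born]
      rw [dictWT_kind0 hk]
      omega
  | Gen.renew G e h, hc => by
      simp only [ConsistentT] at hc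
      obtain ⟨hG, -, -, hr, -⟩ := hc
      have ih := consistentT_rootStep_lt_reach hG
      simp only [Gen.rootStep_renew, Gen.reach_renew]
      omega
  | Gen.merge X Y e, hc => by
      simp only [ConsistentT] at hc
      obtain ⟨-, -, -, hx, hx', -, -, -⟩ := hc
      simp only [Gen.rootStep_merge, Gen.reach_merge]
      omega

/-- **… AND ALL ITS EVENTS HAPPEN AT STEPS `≤ K`** [folklore] -/
theorem consistentT_maxStep_le : ∀ {G : Gen ε}, ConsistentT sh C K R G → maxStep (PEv.step ∘ sh) G ≤ K
  | Gen.born b j, hc => by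
      simp only [ConsistentT] at hc
      obtain ⟨-, hs, hj⟩ := hc
      simpa [hs] using hj
  | Gen.renew G e h, hc => by
      simp only [ConsistentT] at hc
      obtain ⟨hG, -, hs, -, hK⟩ := hc
      have ih := consistentT_maxStep_le hG
      simp only [maxStep_renew, Function.comp_apply, hs]
      exact max_le ih hK
  | Gen.merge X Y e, hc => by
      simp only [ConsistentT] at hc
      obtain ⟨hX, hY, -, -, -, -, -, hK⟩ := hc
      have ihX := consistentT_maxStep_le hX
      have ihY := consistentT_maxStep_le hY
      simp only [maxStep_merge, Function.comp_apply]
      exact max_le (max_le ihX ihY) hK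

/-- **… AND IT IS BORN AT A STEP `≤ K`** [folklore] -/
theorem consistentT_rootStep_le : ∀ {G : Gen ε}, ConsistentT sh C K R G → G.rootStep ≤ K
  | Gen.born b j, hc => by simp only [ConsistentT] at hc; simpa using hc.2.2
  | Gen.renew G e h, hc => by
      simp only [ConsistentT] at hc
      simpa using consistentT_rootStep_le hc.1
  | Gen.merge X Y e, hc => by
      simp only [ConsistentT] at hc
      simpa using Or.inl (consistentT_rootStep_le hc.1)

/-- **UNDER CONSISTENCY A RENEWAL IS AUTOMATICALLY CHRONOLOGICAL**: it is recorded at the line's reach, after every event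
of the line and after its root birth; only the merger clauses of `Chrono` are news. [folklore] -/
theorem consistentT_chrono_renew {G : Gen ε} {e : ε} {h : ℕ} (hc : ConsistentT sh C K R (Gen.renew G e h))
    (hG : Chrono (PEv.step ∘ sh) G) : Chrono (PEv.step ∘ sh) (Gen.renew G e h) := by
  simp only [ConsistentT] at hc
  obtain ⟨hcG, -, hs, hr, -⟩ := hc
  have h1 := consistentT_rootStep_lt_reach hcG
  have h2 := consistentT_maxStep_lt_reach hcG
  refine ⟨hG, ?_, ?_⟩
  · simp only [Function.comp_apply, hs]; omega
  · simp only [Function.comp_apply, hs]; omega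

variable [DecidableEq ε]

/-- **A CONSISTENT CHRONOLOGICAL TAGGED GENEALOGY WITHIN THE CLASS CAP IS A CANONICAL BRANCHING RECORD** of its own fuel,
main line born at its root step from the birth kinds, events `≤ T` for any `T ≥` its latest step: its shape-relabelling
lies in `fam menuRen menuMer (dictB Dcap K ·) (fuel G) (dictB Dcap K G.rootStep) G.rootStep T`. Structural induction:
a birth is `born_mem_fam` (its shape is a birth kind); a renewal at `h + 1 = reach` is `renew_mem_fam` at
`t = h + 1 ∈ (rootStep, T]` on top of the line (events `< reach`); a merger at `t` is `merge_mem_fam` with the older line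
first and the partner born at `s′ ∈ [rootStep, t]` — exactly the clauses of `Chrono`. [folklore] -/
theorem mem_fam_of_chrono (Dcap : ℕ → ℕ) :
    ∀ {G : Gen ε}, ConsistentT sh C K R G → Chrono (PEv.step ∘ sh) G →
      (∀ e ∈ G.events, (sh e).kind = 0 → (sh e).fat < Dcap K) → ∀ {T : ℕ}, maxStep (PEv.step ∘ sh) G ≤ T →
      relabel (shape ∘ sh) G ∈ fam menuRen menuMer (dictB Dcap K) (fuel G) (dictB Dcap K G.rootStep) G.rootStep T
  | Gen.born b j, hc, _, hfat, T, _ => by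
      simp only [ConsistentT] at hc
      obtain ⟨hk, hs, -⟩ := hc
      simp only [relabel_born, fuel_born, Gen.rootStep_born, Function.comp_apply]
      refine born_mem_fam ?_
      rw [← hs]
      exact shape_mem_dictB hk (hfat b (by simp) hk)
  | Gen.renew G e h, hc, hch, hfat, T, hT => by
      simp only [ConsistentT] at hc
      obtain ⟨hG, hk, hs, hr, -⟩ := hc
      obtain ⟨hchG, -, -⟩ := hch
      have hlt := consistentT_rootStep_lt_reach hG
      have hmx := consistentT_maxStep_lt_reach hG
      have ih := mem_fam_of_chrono Dcap hG hchG (fun e' he' => hfat e' (by simp [he'])) (T := h + 1) (by omega)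
      simp only [maxStep_renew, Function.comp_apply, hs] at hT
      simp only [relabel_renew, fuel_renew, Gen.rootStep_renew, Function.comp_apply]
      have hmem := renew_mem_fam (Lren := menuRen) (Lmer := menuMer) (Lpart := dictB Dcap K) (t := h + 1) (K := T)
        (e := shape (sh e)) (Finset.mem_Ioc.2 ⟨by omega, le_of_max_le_right hT⟩)
        (by rw [shape_of_kind1 hk, hs]; simp) ih
      simpa using hmem
  | Gen.merge X Y e, hc, hch, hfat, T, hT => by
      simp only [ConsistentT] at hc
      obtain ⟨hX, hY, hk, -, -, hy, -, -⟩ := hc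
      obtain ⟨hchX, hchY, hXY, hlt, hmX, hmY⟩ := hch
      have ihX := mem_fam_of_chrono Dcap hX hchX (fun e' he' => hfat e' (by simp [he'])) hmX
      have ihY := mem_fam_of_chrono Dcap hY hchY (fun e' he' => hfat e' (by simp [he'])) hmY
      simp only [maxStep_merge, Function.comp_apply] at hT
      simp only [Function.comp_apply] at hlt
      simp only [relabel_merge, fuel_merge, Gen.rootStep_merge, min_eq_left hXY, Function.comp_apply]
      exact merge_mem_fam (t := (sh e).step) (Finset.mem_Ioc.2 ⟨hlt, le_of_max_le_right hT⟩)
        (by rw [shape_of_kind2 hk]; simp) (s' := Y.rootStep) (Finset.mem_Icc.2 ⟨hXY, hy⟩)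
        (fam_mono (le_max_left _ _) _ _ _ ihX) (fam_mono (le_max_right _ _) _ _ _ ihY)

/-- **… HENCE A RECORD OF THE CANONICAL RUN AT CUTOFF `K`** whenever its fuel is within the run's: `relabel (shape ∘ sh) G ∈
canonFam Dcap Ncap K G.rootStep`. [folklore] -/
theorem mem_canonFam_of_chrono {Dcap Ncap : ℕ → ℕ} {G : Gen ε} (hc : ConsistentT sh C K R G)
    (hch : Chrono (PEv.step ∘ sh) G) (hfat : ∀ e ∈ G.events, (sh e).kind = 0 → (sh e).fat < Dcap K)
    (hn : fuel G ≤ Ncap K) : relabel (shape ∘ sh) G ∈ canonFam Dcap Ncap K G.rootStep :=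
  fam_mono hn _ _ _ (mem_fam_of_chrono Dcap hc hch hfat (consistentT_maxStep_le hc))

/-- **THE EQUIVALENCE**: for a consistent tagged genealogy within the caps, its shape is a record of the canonical run
IFF it is chronological (`chrono_of_mem_fam` on the shape + invariance of chronology under the step-preserving
relabelling `shape ∘ sh`). [folklore] -/
theorem mem_canonFam_iff_chrono {Dcap Ncap : ℕ → ℕ} {G : Gen ε} (hc : ConsistentT sh C K R G)
    (hfat : ∀ e ∈ G.events, (sh e).kind = 0 → (sh e).fat < Dcap K) (hn : fuel G ≤ Ncap K) :
    relabel (shape ∘ sh) G ∈ canonFam Dcap Ncap K G.rootStep ↔ Chrono (PEv.step ∘ sh) G := by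
  refine ⟨fun h => ?_, fun hch => mem_canonFam_of_chrono hc hch hfat hn⟩
  have h' := (chrono_of_mem_fam (Lren := menuRen) (Lmer := menuMer) (Lpart := dictB Dcap K) (st := PEv.step)
    menuRen_step menuMer_step (dictB_step Dcap K) (Ncap K) (dictB Dcap K G.rootStep) G.rootStep K
    (dictB_step Dcap K G.rootStep) (consistentT_rootStep_le hc) _ h).1
  exact (chrono_relabel_iff (shape ∘ sh) (st := PEv.step ∘ sh) (st' := PEv.step) (fun _ => rfl) G).1 h'

/-- **… AND ITS BRANCHING SLOT IS LIVE**: `⟨G.rootStep, z, relabel (shape ∘ sh) G⟩ ∈ bliveSlots Cell (canonFam Dcap Ncap)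
K` for every birth cell `z` of age `K − G.rootStep` (the "⊆ bliveSlots" half of the count's binder `hstr`). [folklore] -/
theorem mem_bliveSlots_of_chrono {γ : Type*} (Cell : ℕ → ℕ → Finset γ) {Dcap Ncap : ℕ → ℕ} {G : Gen ε}
    (hc : ConsistentT sh C K R G) (hch : Chrono (PEv.step ∘ sh) G)
    (hfat : ∀ e ∈ G.events, (sh e).kind = 0 → (sh e).fat < Dcap K) (hn : fuel G ≤ Ncap K) {z : γ}
    (hz : z ∈ Cell K (K - G.rootStep)) :
    (⟨G.rootStep, z, relabel (shape ∘ sh) G⟩ : BSlot γ PEv) ∈ bliveSlots Cell (canonFam Dcap Ncap) K := by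
  simp only [bliveSlots, Finset.mem_sigma, Finset.mem_range]
  exact ⟨Nat.lt_succ_of_le (consistentT_rootStep_le hc), hz, mem_canonFam_of_chrono hc hch hfat hn⟩

/-- **… AND OLD when born before the cut `j⋆ K`** (the "∃ old slot" half of `hstr`). [folklore] -/
theorem mem_boldSlots_of_chrono {γ : Type*} (Cell : ℕ → ℕ → Finset γ) {Dcap Ncap : ℕ → ℕ} (jstar : ℕ → ℕ)
    {G : Gen ε} (hc : ConsistentT sh C K R G) (hch : Chrono (PEv.step ∘ sh) G)
    (hfat : ∀ e ∈ G.events, (sh e).kind = 0 → (sh e).fat < Dcap K) (hn : fuel G ≤ Ncap K) {z : γ}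
    (hz : z ∈ Cell K (K - G.rootStep)) (hold : G.rootStep < jstar K) :
    (⟨G.rootStep, z, relabel (shape ∘ sh) G⟩ : BSlot γ PEv) ∈ boldSlots Cell (canonFam Dcap Ncap) jstar K := by
  simp only [boldSlots, Finset.mem_sigma, Finset.mem_range]
  exact ⟨hold, hz, mem_canonFam_of_chrono hc hch hfat hn⟩

end ChronoAreCounted

/-! ## §5 The canonical budgets: `a = μ = e^{−E₀}`, `ν = ρ̄ =` the geometric birth mass -/

section Budgets

/-- the renewal menu weighs `e^{−E₀}` (the budget `a` of the count, attained) [folklore] -/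
theorem sum_menuRen_eta (C : T4PrintedShapeBanking.Consts) (t : ℕ) :
    ∑ e ∈ menuRen t, eta C e = Real.exp (-C.E₀) := by
  simp [menuRen, eta_renew]

/-- the merger menu weighs `e^{−E₀}` (the budget `μ` of the count, attained) [folklore] -/
theorem sum_menuMer_eta (C : T4PrintedShapeBanking.Consts) (t : ℕ) :
    ∑ e ∈ menuMer t, eta C e = Real.exp (-C.E₀) := by
  simp [menuMer, eta_merge]

/-- **THE GEOMETRIC BIRTH MASS** `e^{−Eb}·e^{−μ}/(1 − e^{−μ}) = Σ_{d′ ≥ 0} e^{−(Eb + μ(d′+1))}` — the budgets `ν` (partner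
births) and `ρ̄` (root births, whose extra factor `e^{−2p₀} ≤ 1`) of the count, for a positive fatness margin `μ`.
[folklore] -/
def birthMass (C : T4PrintedShapeBanking.Consts) : ℝ := Real.exp (-C.Eb) * (Real.exp (-C.μ) / (1 - Real.exp (-C.μ)))

/-- the birth mass is nonnegative for `μ > 0` [folklore] -/
theorem birthMass_nonneg {C : T4PrintedShapeBanking.Consts} (hμ : 0 < C.μ) : 0 ≤ birthMass C := by
  have h1 : Real.exp (-C.μ) < 1 := Real.exp_lt_one_iff.2 (by linarith)
  exact mul_nonneg (Real.exp_pos _).le (div_nonneg (Real.exp_pos _).le (by linarith))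

/-- a sum over the birth kinds is a sum over the classes `d′ < Dcap K` [folklore] -/
theorem sum_dictB_eq (Dcap : ℕ → ℕ) (K j : ℕ) (f : PEv → ℝ) :
    ∑ b ∈ dictB Dcap K j, f b = ∑ d ∈ Finset.range (Dcap K), f ((j, 0, d) : PEv) := by
  rw [dictB, Finset.sum_product, Finset.sum_singleton, Finset.sum_product, Finset.sum_singleton]

/-- the truncated geometric series `Σ_{d < D} x^{d+1} ≤ x/(1 − x)` for `0 ≤ x < 1` [folklore] -/
theorem geom_range_succ_le {x : ℝ} (hx0 : 0 ≤ x) (hx1 : x < 1) (D : ℕ) :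
    ∑ d ∈ Finset.range D, x ^ (d + 1) ≤ x / (1 - x) := by
  have h : ∑ d ∈ Finset.range D, x ^ (d + 1) = ∑ i ∈ Finset.Ico 1 (D + 1), x ^ i := by
    rw [Finset.sum_Ico_eq_sum_range]
    simp [add_comm]
  rw [h]
  simpa using geom_sum_Ico_le_of_lt_one (m := 1) (n := D + 1) hx0 hx1

/-- `e^{−(Eb + μ(d′+1))} = e^{−Eb}·(e^{−μ})^{d′+1}` [folklore] -/
theorem exp_birthMargin_eq (C : T4PrintedShapeBanking.Consts) (d : ℕ) :
    Real.exp (-(C.Eb + C.μ * ((d : ℝ) + 1))) = Real.exp (-C.Eb) * Real.exp (-C.μ) ^ (d + 1) := by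
  rw [← Real.exp_nat_mul, ← Real.exp_add]
  congr 1
  push_cast
  ring

/-- **THE PARTNER MENU IS WITHIN THE BIRTH MASS**: `Σ_{b ∈ dictB Dcap K s} η b ≤ birthMass C` (the budget `ν`), for `μ > 0`.
[folklore] -/
theorem sum_dictB_eta_le {C : T4PrintedShapeBanking.Consts} (hμ : 0 < C.μ) (Dcap : ℕ → ℕ) (K s : ℕ) :
    ∑ b ∈ dictB Dcap K s, eta C b ≤ birthMass C := by
  have hx0 : 0 ≤ Real.exp (-C.μ) := (Real.exp_pos _).le
  have hx1 : Real.exp (-C.μ) < 1 := Real.exp_lt_one_iff.2 (by linarith)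
  rw [sum_dictB_eq]
  simp only [eta_birth, exp_birthMargin_eq, ← Finset.mul_sum]
  exact mul_le_mul_of_nonneg_left (geom_range_succ_le hx0 hx1 _) (Real.exp_pos _).le

/-- **THE ROOT MENU IS WITHIN THE BIRTH MASS**: `Σ_{b ∈ dictB Dcap K j} ρ b ≤ birthMass C` (the budget `ρ̄`), for `μ > 0`
and a nonnegative profile `p₀(g_j) ≥ 0` (so the root's extra factor `e^{−2p₀(g_j)}` is `≤ 1`). [folklore] -/
theorem sum_dictB_rho_le {C : T4PrintedShapeBanking.Consts} (hμ : 0 < C.μ) {g : ℕ → ℝ} (Dcap : ℕ → ℕ) (K j : ℕ)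
    (hP : 0 ≤ p0Profile C.A₀ C.p₀ (g j)) : ∑ b ∈ dictB Dcap K j, rho C g b ≤ birthMass C := by
  refine le_trans (Finset.sum_le_sum fun b hb => ?_) (sum_dictB_eta_le hμ Dcap K j)
  obtain ⟨hs, hk, -⟩ := mem_dictB.1 hb
  rw [rho_eq, eta_eq, reserve_kind0 (C := C) (g := g) hk, hs, neg_add, Real.exp_add]
  have h2 : Real.exp (-(2 * p0Profile C.A₀ C.p₀ (g j))) ≤ 1 := Real.exp_le_one_iff.2 (by linarith)
  exact (mul_le_of_le_one_left (Real.exp_pos _).le h2)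

/-- the profile is nonnegative at a coupling `0 < g ≤ 1` for `A₀ ≥ 0` (how the binder `hP` is met along a run of the
typed flow, where `1 ≤ log g⁻²`). [folklore] -/
theorem p0Profile_nonneg_of_le_one {A₀ g : ℝ} (p₀ : ℕ) (hA : 0 ≤ A₀) (hg : 0 < g) (hg1 : g ≤ 1) :
    0 ≤ p0Profile A₀ p₀ g := by
  unfold p0Profile
  have hlog : 0 ≤ Real.log ((g ^ 2)⁻¹) := by
    apply Real.log_nonneg
    have hg2 : g ^ 2 ≤ 1 := by nlinarith
    have hg2pos : 0 < g ^ 2 := by positivity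
    rw [le_inv_comm₀ one_pos hg2pos, inv_one]
    exact hg2
  positivity

/-- … and whenever `1 ≤ log g⁻²` (the binder of the chain's end-to-end theorems) for `A₀ ≥ 0`. [folklore] -/
theorem p0Profile_nonneg_of_one_le_log {A₀ g : ℝ} (p₀ : ℕ) (hA : 0 ≤ A₀) (hx : 1 ≤ Real.log ((g ^ 2)⁻¹)) :
    0 ≤ p0Profile A₀ p₀ g := by
  unfold p0Profile
  exact mul_nonneg hA (pow_nonneg (by linarith) _)

end Budgets

/-! ## §6 End to end over the canonical menus: the menu datum, `hst` and the four budgets discharged -/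

section EndToEndC

variable {ε γ κ ι : Type*} [DecidableEq ε] [DecidableEq γ] [DecidableEq κ] {l₀ : ℝ} {K₀ : ℕ} {π : ℕ → ι → κ}
  {T : ℕ → Finset ι} {A A' : ℕ → ℝ → ι → ℝ} {Bad' : ℕ → ℝ → Finset κ} {dead dead' : ℕ → ℝ → ι → ℝ}
  {F Rf F' Rf' : ℕ → κ → ℝ} {nlow nup mlow mup : ℕ → ℝ → ℝ} {Cn : ℝ}

/-- **END TO END OVER THE CANONICAL MENUS.**  `T4TaggedShapeBanking.exists_irThreshold_relWeightBoundT` with the menu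
datum `Lren Lmer Lpart Lroot ↦ menuRen, menuMer, dictB Dcap K, dictB Dcap K` plugged: the step-faithfulness binder `hst`
is `menuMer_step`, the four budgets are ATTAINED / BOUNDED by §5 — `a = μ = e^{−E₀}` (`sum_menuRen_eta`, `sum_menuMer_eta`),
`ν = ρ̄ = birthMass C` (`sum_dictB_eta_le`, `sum_dictB_rho_le`) — at the cost of two displayed binders: a positive
fatness margin `0 < C.μ` and a nonnegative profile `0 ≤ p₀(g_{K,s})` along every run (met by `0 < g ≤ 1`,
`p0Profile_nonneg_of_le_one`).  What remains displayed: the caps `Dcap`, `Ncap`, the cells, `η̄₊`, the age datum `Λ′`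
with its rate and fixed point — now the explicit inequality
`(e^{−E₀} + e^{−E₀}·birthMass C·(Λ′e^{−κ₁}/(1 − Λ′e^{−κ₁}e^{η̄₊})))·e^{η̄₊} ≤ e^{η̄₊} − 1` in the constants —, the root rate,
the cut `j⋆`, the labelling binder `hlabT` over `canonFam Dcap Ncap` (whose "∈ runFam" and slot halves §4 makes kernel
for chronological genealogies), the two `Regeneration` runs and the domination; conclusion `∃ K₁ ≥ K₀, RelWeightBound …`
with budget `𝟙·C·recordsBudget (birthMass C) C.κ₁ V Λ η̄₊ j⋆`. [folklore] -/
theorem exists_irThreshold_relWeightBound_canon (sh : ε → PEv) (C : T4PrintedShapeBanking.Consts) (hC : C.Valid)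
    (ha₀ : 0 < C.a) (hA₀ : 0 < C.A₀) (hμ₀ : 0 < C.μ) {L r : ℕ} (hL : 1 ≤ L) {β₀ : ℝ} (hβ : 0 ≤ β₀)
    (hrq : r * (C.q' + 1) < C.p₀)
    (Cell : ℕ → ℕ → Finset γ) {V Λ : ℝ} (hV : 0 ≤ V) (hΛ : 0 < Λ)
    (hcell : ∀ K a, ((Cell K a).card : ℝ) ≤ V * Λ ^ a) (Dcap Ncap : ℕ → ℕ)
    (jstar : ℕ → ℕ) (hj : ∀ K, jstar K ≤ K) {c : ℝ} (hc : 0 < c)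
    (hfrac : ∀ K : ℕ, c * K ≤ ((K - jstar K : ℕ) : ℝ))
    (hA : Regeneration l₀ π T A Bad' dead F Rf nlow nup Cn K₀)
    (hA' : Regeneration l₀ π T A' Bad' dead' F' Rf' mlow mup Cn K₀) (hCn : 0 ≤ Cn) :
    ∃ x₀ : ℝ, ∀ (R : ℕ → ℕ → ℕ) (g : ℕ → ℕ → ℝ) (β' : ℕ → ℝ),
      (∀ K, K₀ ≤ K → B14.FlowIneq27 (g K) (β' K) β₀ C.p₀ K) →
      (∀ K, K₀ ≤ K → B14FlowStep.FlowIneq29 (R K) (g K) L (β' K) β₀ K) →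
      (∀ K, K₀ ≤ K → ∀ s, s ≤ K → B14.IsRj L r (g K s) (R K s)) →
      (∀ K, K₀ ≤ K → ∀ s, s ≤ K → 1 ≤ Real.log ((g K s) ^ 2)⁻¹) →
      (∀ K, K₀ ≤ K → x₀ ≤ Real.log ((g K K) ^ 2)⁻¹) →
      (∀ K s, 0 ≤ p0Profile C.A₀ C.p₀ (g K s)) →
      ∀ {ηplus : ℝ}, 0 ≤ ηplus → Λ * Real.exp (ηplus - C.κ₁) < 1 →
      ∀ {Λ' : ℝ}, 0 ≤ Λ' → Λ' * Real.exp (-C.κ₁) * Real.exp ηplus < 1 →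
      (Real.exp (-C.E₀) + Real.exp (-C.E₀) * birthMass C *
          (Λ' * Real.exp (-C.κ₁) / (1 - Λ' * Real.exp (-C.κ₁) * Real.exp ηplus))) * Real.exp ηplus ≤
        Real.exp ηplus - 1 →
      ∀ (y : ℕ → ℕ → γ → Gen PEv → ℝ),
      (∀ K, ∀ j ≤ K, ∀ z ∈ Cell K (K - j), ∀ G ∈ canonFam Dcap Ncap K j, 0 ≤ y K j z G) →
      (∀ K, K₀ ≤ K → ∀ j ≤ K, ∀ z ∈ Cell K (K - j), ∀ G ∈ canonFam Dcap Ncap K j,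
        y K j z G ≤ 0 ∨ ∃ G' : Gen ε, ConsistentT sh C K (R K) G' ∧ G'.WF (dictWT sh (R K) C.n₁) ∧
          K < G'.reach (dictWT sh (R K) C.n₁) ∧ relabel (shape ∘ sh) G' = G ∧
          y K j z G ≤ Λ' ^ partnerAges (PEv.step ∘ sh) G' * (Real.exp (-credits (credit C (g K) ∘ sh) G') *
            Real.exp (lifeCost (dictWT sh (R K) C.n₁) (costT sh C K (R K)) G'))) →
      ∀ (str : ℕ → κ → Finset (BSlot γ PEv)),
      (∀ K t, |t| ≤ l₀ → K₀ ≤ K → Set.InjOn (str K) (Bad' K t)) →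
      (∀ K t, |t| ≤ l₀ → K₀ ≤ K → ∀ c ∈ Bad' K t,
        str K c ⊆ bliveSlots Cell (canonFam Dcap Ncap) K ∧
          ∃ o ∈ boldSlots Cell (canonFam Dcap Ncap) jstar K, o ∈ str K c) →
      (∀ K t, |t| ≤ l₀ → K₀ ≤ K → ∀ c ∈ Bad' K t, F K c * Rf K c ≤ famWeight (bslotPrice (y K)) (str K c)) →
      (∀ K t, |t| ≤ l₀ → K₀ ≤ K → ∀ c ∈ Bad' K t, F' K c * Rf' K c ≤ famWeight (bslotPrice (y K)) (str K c)) →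
      ∃ K₁, K₀ ≤ K₁ ∧ RelWeightBound l₀ T A A' (fun K t => if K₁ ≤ K then badOfClass π T Bad' K t else ∅)
        (Set.indicator {K | K₁ ≤ K} (fun K => Cn * recordsBudget (birthMass C) C.κ₁ V Λ ηplus jstar K)) := by
  obtain ⟨x₀, hx₀⟩ := exists_irThreshold_relWeightBoundT sh C hC ha₀ hA₀ hL hβ hrq Cell hV hΛ hcell
    (fun _ => menuRen) (fun _ => menuMer) (dictB Dcap) (dictB Dcap) Ncap (fun _ t => menuMer_step t) jstar hj hc hfrac
    hA hA' hCn
  refine ⟨x₀, ?_⟩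
  intro R g β' h27 h29 hR hx1 hir hP ηplus hηplus hr Λ' hΛ0 h1 hx y hy0 hlabT str hinj hstr hF hF'
  exact hx₀ R g β' h27 h29 hR hx1 hir (fun K j => sum_dictB_rho_le hμ₀ Dcap K j (hP K j))
    (fun K t => (sum_menuRen_eta C t).le) (fun K t => (sum_menuMer_eta C t).le) (fun K s => sum_dictB_eta_le hμ₀ Dcap K s)
    hηplus hr hΛ0 h1 hx y hy0 hlabT str hinj hstr hF hF'

end EndToEndC

/-! ## §7 Sanity: the tagged two-branch history of `T4TaggedShapeBanking` §8 is chronological and its count membership is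
now DERIVED; a consistent well-formed pending genealogy that is NOT chronological, whose shape is NOT counted -/

section Sanity

namespace Sanity

open T4PrintedShapeBanking.XreadC4 T4TaggedShapeBanking.Sanity

/-- the two-branch history `Zt` (parallel equal births at step `0`, renewals at `4`, merger at `5`) is chronological
(decided) [folklore] -/
theorem chrono_Zt : Chrono (PEv.step ∘ Prod.fst) Zt := by decide

/-- its fuel is `3`, its latest step is `5`, its root step is `0` (decided) [folklore] -/
theorem fuel_Zt : fuel Zt = 3 ∧ maxStep (PEv.step ∘ Prod.fst) Zt = 5 ∧ Zt.rootStep = 0 := by decide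

/-- all its births are thin (class `0`) [folklore] -/
theorem thin_Zt : ∀ e ∈ Zt.events, (Prod.fst e).kind = 0 → (Prod.fst e).fat < 1 := by decide

/-- **ITS COUNT MEMBERSHIP IS NOW A COROLLARY** of §4: the shape `relabel (shape ∘ Prod.fst) Zt` is a record of EVERY
canonical run at cutoff `8` born at `0` whose caps allow thin classes and fuel `3` (caps kept symbolic, as the fuel was in
gen 14, so that nothing enumerates the family).  At `Dcap ≡ 1` the canonical menus are the one-label menus of
`T4BranchingRecordsGas` §8 (`T4RecordChains.dictB_one`: `dictB (fun _ ↦ 1) K s = {(s,0,0)}`; `menuRen`, `menuMer` are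
`Sanity.Lren`, `Sanity.Lmer` by `rfl`), so gen 14's hand-assembled `T4TaggedShapeBanking.Sanity.Zflat_mem` is the
instance `Ncap ≡ n + 3` of this corollary (not restated here). [folklore] -/
theorem Zt_mem_canonFam (Dcap Ncap : ℕ → ℕ) (hD : 1 ≤ Dcap 8) (hN : 3 ≤ Ncap 8) :
    relabel (shape ∘ Prod.fst) Zt ∈ canonFam Dcap Ncap 8 0 := by
  have h := mem_canonFam_of_chrono (sh := Prod.fst) (C := C₀) (K := 8) (R := fun _ => 2) (Dcap := Dcap) (Ncap := Ncap)
    Zt_consistent.1 chrono_Zt (fun e he hk => lt_of_lt_of_le (thin_Zt e he hk) hD) (by rw [fuel_Zt.1]; exact hN)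
  rwa [fuel_Zt.2.2] at h

/-- **A NON-CHRONOLOGICAL CONSISTENT GENEALOGY**: a thin region born at `0`, RENEWED AT STEP `4` (readiness `3 + 1 =`
its reach `0 + (1 + 2 + 1)`), then recorded as MERGED AT STEP `3` with a thin region born at `2` — the merger step lies in
both pending lives (`[0, 7)` and `[2, 6)`), so the term is consistent, but it nests a later event inside an earlier one.
[folklore] -/
def Nc : Gen PEv := Gen.merge (Gen.renew (Gen.born (0, 0, 0) 0) (4, 1, 0) 3) (Gen.born (2, 0, 0) 2) (3, 2, 0)

/-- `Nc` is consistent at cutoff `8` on the table `R ≡ 2`, `n₁ = 1`, and pending there (`8 < 10 =` its reach) … [folklore] -/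
theorem Nc_consistent : ConsistentT (id : PEv → PEv) C₀ 8 (fun _ => 2) Nc ∧
    8 < Nc.reach (dictWT (id : PEv → PEv) (fun _ => 2) C₀.n₁) := by
  constructor
  · simp [ConsistentT, Nc, C₀, Gen.reach, Gen.rootStep, dictW, PEv.kind, PEv.step, PEv.fat, fatWait]
  · simp [Nc, C₀, Gen.reach, dictW, PEv.kind, PEv.fat, fatWait]

/-- … and well formed (its three labels are distinct, the renewal is at readiness, the partners' lives overlap) …
[folklore] -/
theorem Nc_wf : Nc.WF (dictWT (id : PEv → PEv) (fun _ => 2) C₀.n₁) := by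
  simp [Gen.WF, Nc, C₀, Gen.reach, Gen.rootStep, dictW, PEv.kind, PEv.fat, fatWait]

/-- … but NOT chronological (the absorbed line's renewal step `4` exceeds the merger step `3`; decided) … [folklore] -/
theorem Nc_not_chrono : ¬ Chrono (PEv.step ∘ (id : PEv → PEv)) Nc := by decide

/-- its shape-relabelling along `id` is itself (its labels are already shapes) [folklore] -/
theorem relabel_shape_Nc : relabel (shape ∘ (id : PEv → PEv)) Nc = Nc := by decide

/-- … so ITS SHAPE IS NOT A RECORD OF ANY CANONICAL FAMILY born at `0`, for any class cap, fuel and cutoff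
(`chrono_of_mem_fam`): the chronology clause of §4 is load-bearing — consistency, well-formedness and pendingness alone do
not place a tagged genealogy in the count. [folklore] -/
theorem Nc_not_mem (Dcap : ℕ → ℕ) (K n T : ℕ) :
    relabel (shape ∘ (id : PEv → PEv)) Nc ∉ fam menuRen menuMer (dictB Dcap K) n (dictB Dcap K 0) 0 T := by
  rw [relabel_shape_Nc]
  intro h
  exact Nc_not_chrono (chrono_of_mem_fam (st := PEv.step) menuRen_step menuMer_step (dictB_step Dcap K) n
    (dictB Dcap K 0) 0 T (dictB_step Dcap K 0) (Nat.zero_le T) Nc h).1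

/-- … in particular not a record of any canonical run at any cutoff [folklore] -/
theorem Nc_not_mem_canonFam (Dcap Ncap : ℕ → ℕ) (K : ℕ) :
    relabel (shape ∘ (id : PEv → PEv)) Nc ∉ canonFam Dcap Ncap K 0 :=
  Nc_not_mem Dcap K (Ncap K) K

end Sanity

end Sanity

end

end T4CanonicalMenus
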